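import Literature.MathematicalPhysics.QuantumFieldTheory.Balaban1983to89.Node00.TkOfRecord
import Literature.MathematicalPhysics.QuantumFieldTheory.Balaban1983to89.Node00.TStepOfRecord

/-!
# NODE 00 — THE FULL-BOND-SET FACE OF 11a's V-FACTOR: on the whole lattice, the restricted kernel transport of record (2.21) IS def-T's
# one-step transport of record (3.1), almost everywhere — the first brick of N11's residue (S1ᵀ) on the NO-EXPANSION histories

Cell `pub-ymgap`, YM-PLAN Track A (HUMAN RULING D-0062); author seat `pub-ymgap-dag-n11-d` (g2; R134 fan-out seat N11 [B14], strategy s2, «the T-DAY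
consumer»), dag-lead DEDUP-216 GO; lineage item K1′ `StabilityBAtRecordR12e` = stmt-QuantumFields-19903.  A sibling of def-T's 11a `Node00.TkOfRecord`
([III] (2.18)–(2.22): the multi-scale operation `𝐓_k(s)` of record, V-factor `Tk.vOp` over the RESTRICTED kernel transport `kernelRTOfRecord` on a pair of bond
sets, typed on the subtype configurations `↥sV → SU N`) and of def-T's FILE 1 `Node00.TStepOfRecord` ([III] (3.1): the T-step of record, `transportOfRecord
= T4AveragingDisintegration.transportK (avOfRecord …).avg`, typed on `GaugeField`).  [III] = [Balaban1988Convergent].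

WHY.  Node N11's residue at the Stage-12 record is (S1ᵀ) «`SLaw₁₂ θ P k → TLaw₁₂ θ P k`» ([III] Theorem p. 245 at the objects of record); its first concrete
instances are the NO-EXPANSION new steps — new sequences `s′` with `Ω_{k+1}(s′) = ∅` (hence `Λ_{k+1} = ∅`), where print performs no background-field
expansion and creates no new terms: `(𝐓_{k+1} e^{A_{k+1}})(s′)` is the plain transport of the weighted old slot ((2.22): no A-integral).  There
`TLaw₁₂`'s (3.25) identity compares def-T's pre-𝐑 slot `slotT_{k+1}(s′) = transportOfRecord (w(s′)·χ_k·slot_k)` (`tstepOfRecord_apply`) with 11a's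
`𝐓_{k+1}(s′)`, whose newest generation has V-bonds = ALL level-`k` bonds, image = ALL level-`(k+1)` bonds and NO A-bonds (§2) — i.e. with the restricted
kernel transport ON THE FULL BOND SETS.  The two transports are kernel versions of the SAME disintegration along Bałaban's averaging of record, typed
on different configuration spaces; this file proves they AGREE ALMOST EVERYWHERE in the coarse field (the version caveat of both files: pointwise
agreement is not claimed and not true in general), for every bounded jointly measurable integrand family that may read the coarse field — the shape
in which 11a's operand reads the retained configuration `𝐖 (k+1) = V′`.

WHAT THIS FILE PROVES (0 `sorry`, 0 `def`, 0 `instance`; `N`-generic).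
§1 **`kernelRTOfRecord_full_ae_eq_transportOfRecord`** — for `j < K` (the `HaarAC` range of `avOfRecord`), `sV ∕ sV′` finsets containing EVERY bond and
   `f : GaugeField _ (j+1) _ → (↥sV → SU N) → ℝ` jointly measurable and bounded:
   `(V ↦ kernelRTOfRecord F N K j sV sV′ (f V) (V|sV′)) =ᵐ[fieldMeasure] (V ↦ transportOfRecord F N K j (U ↦ f V (U|sV)) V)`.
   Proof: the reindexings `↥sV ≃ PBond` (`Equiv.subtypeUnivEquiv`, `MeasurableEquiv.piCongrLeft`) preserve product Haar (`measurePreserving_piCongrLeft`);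
   the restricted averaging on the full bond set IS `avOfRecord` through them (`avgRestrOfRecord_eq_of_forall_mem`); both sides are integrable
   (`integrable_margDensity_mul` + `integral_compProd`) and have the same integral against every bounded measurable test function
   (`integral_graph_eq` on each side + two changes of variables), so `ae_eq_of_forall_integral_mul_eq` applies.  `…_const` — the `V`-independent case.
§2 THE NO-EXPANSION GENERATION OF RECORD: `mem_toFinset_bondsIn_of_forall_mem` (a region containing every site carries every bond), `mem_sV_of_Omega_empty` ∕
   `mem_sV'_of_Omega_empty` (at `Ω_{j+1}(s) = ∅` the generation-`j` bond sets of `genDataOfRecord` are FULL), `isEmpty_sA_of_Omega_empty` (no A-bonds),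
   **`genOp_genDataOfRecord_of_Omega_empty`** (the generation is the full-bond restricted transport of `ζ_j(T)·w_A·(operand)` — (2.22), `Tk.aOp_of_isEmpty`).
   With §1 the consumer of `TLaw₁₂ θ P k` at a no-expansion `s′` rewrites 11a's slot into def-T's transport of an EXPLICIT integrand, a.e.; what then
   remains of the (3.25) identity there is an identity of integrands along the fibre (weights of record vs step weights of record), for the definers ∕ the
   K1′ witness to meet — not asserted here.

HONEST SCOPE.  Measure-theoretic bookkeeping on the tree's own kernels (`T4AveragingDisintegration`); nothing of Bałaban's estimates; no node count moves
(typed 28∕28 · discharged 5∕28); not a discharge of N11.  One finite torus at fixed `ε = L^{−K}`; NOT ℝ⁴ ∕ OS ∕ mass gap ∕ Clay.  Sources: [III] (2.21)–(2.22)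
p. 258, (3.1) p. 264, (3.24)–(3.25) p. 270, Theorem p. 245; [Balaban1985Averaging] (10) p. 19; [Balaban1987RG1] (0.4) p. 253.
-/

noncomputable section

open MeasureTheory

namespace Literature.MathematicalPhysics.QuantumFieldTheory.Balaban1983to89.Node00

open T4AveragingDisintegration T4Continuum T4FiniteEpsInhabited Tk

variable (F : T4Family) (N : ℕ) [NeZero N]

/-! ## §1  The full-bond-set face: restricted kernel transport of record = transport of record, a.e. -/

/-- **THE FULL-BOND-SET FACE OF 11a's V-FACTOR.**  For `j < K`, bond finsets `sV ∕ sV′` containing EVERY bond of `T^{(j)}` ∕ `T^{(j+1)}`, and a bounded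
jointly measurable integrand family `f V y` (reading the coarse field `V` and the fine subtype configuration `y`): 11a's restricted kernel transport of record
applied to `f V` and read at `V|sV′` EQUALS def-T's one-step transport of record of the `V`-slice `U ↦ f V (U|sV)` read at `V`, for `dV`-ALMOST EVERY `V`
(both are versions of `∫ dU δ(ŪV⁻¹) (·)` along Bałaban's averaging of record; a.e. uniqueness of the transform).
[cite: Balaban1988Convergent, (2.21)–(2.22) p.258, (3.1) p.264; Balaban1985Averaging, (10) p.19] -/
theorem kernelRTOfRecord_full_ae_eq_transportOfRecord (K j : ℕ) (hj : j < K) {hdec : DecidableEq (PBond (F.P K) j)}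
    (sV : Finset (PBond (F.P K) j)) (hV : ∀ b, b ∈ sV) (sV' : Finset (PBond (F.P K) (j + 1))) (hV' : ∀ b, b ∈ sV')
    (f : GaugeField (F.P K) (j + 1) (SU N) → (↥sV → SU N) → ℝ) (hf : Measurable (Function.uncurry f)) {C : ℝ}
    (hC : ∀ V y, |f V y| ≤ C) :
    (fun V => kernelRTOfRecord F N K j sV sV' (f V) (fun b => V b)) =ᵐ[fieldMeasure (F.P K) (j + 1) (SU N)]
      fun V => transportOfRecord F N K j (fun U => f V (fun b => U b)) V := by
  -- the reindexing equivalences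
  let e : ↥sV ≃ PBond (F.P K) j := Equiv.subtypeUnivEquiv hV
  let e' : ↥sV' ≃ PBond (F.P K) (j + 1) := Equiv.subtypeUnivEquiv hV'
  let E : (↥sV → SU N) ≃ᵐ GaugeField (F.P K) j (SU N) := MeasurableEquiv.piCongrLeft (fun _ : PBond (F.P K) j => SU N) e
  let E' : (↥sV' → SU N) ≃ᵐ GaugeField (F.P K) (j + 1) (SU N) :=
    MeasurableEquiv.piCongrLeft (fun _ : PBond (F.P K) (j + 1) => SU N) e'
  have hEs : ∀ (U : GaugeField (F.P K) j (SU N)), E.symm U = fun b : ↥sV => U b.1 := fun U => rfl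
  have hEs' : ∀ (V : GaugeField (F.P K) (j + 1) (SU N)), E'.symm V = fun b : ↥sV' => V b.1 := fun V => rfl
  have hE : ∀ (y : ↥sV → SU N) (b : PBond (F.P K) j), E y b = y ⟨b, hV b⟩ := fun y b => by
    change E y (e ⟨b, hV b⟩) = y ⟨b, hV b⟩
    exact MeasurableEquiv.piCongrLeft_apply_apply e (β := fun _ : PBond (F.P K) j => SU N) y ⟨b, hV b⟩
  have hE' : ∀ (y : ↥sV' → SU N) (b : PBond (F.P K) (j + 1)), E' y b = y ⟨b, hV' b⟩ := fun y b => by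
    change E' y (e' ⟨b, hV' b⟩) = y ⟨b, hV' b⟩
    exact MeasurableEquiv.piCongrLeft_apply_apply e' (β := fun _ : PBond (F.P K) (j + 1) => SU N) y ⟨b, hV' b⟩
  -- measure preservation
  have mpE : MeasurePreserving E (Measure.pi fun _ : ↥sV => (HaarData.haar : Measure (SU N))) (fieldMeasure (F.P K) j (SU N)) := by
    unfold fieldMeasure
    exact measurePreserving_piCongrLeft (fun _ : PBond (F.P K) j => (HaarData.haar : Measure (SU N))) e
  have mpE' : MeasurePreserving E' (Measure.pi fun _ : ↥sV' => (HaarData.haar : Measure (SU N)))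
      (fieldMeasure (F.P K) (j + 1) (SU N)) := by
    unfold fieldMeasure
    exact measurePreserving_piCongrLeft (fun _ : PBond (F.P K) (j + 1) => (HaarData.haar : Measure (SU N))) e'
  have mpEs : MeasurePreserving E.symm (fieldMeasure (F.P K) j (SU N)) (Measure.pi fun _ : ↥sV => (HaarData.haar : Measure (SU N))) :=
    MeasurePreserving.symm E mpE
  have mpE's : MeasurePreserving E'.symm (fieldMeasure (F.P K) (j + 1) (SU N))
      (Measure.pi fun _ : ↥sV' => (HaarData.haar : Measure (SU N))) :=
    MeasurePreserving.symm E' mpE'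
  -- notation
  set μ := fieldMeasure (F.P K) j (SU N) with hμ
  set μ' := fieldMeasure (F.P K) (j + 1) (SU N) with hμ'
  set ν : Measure (↥sV → SU N) := Measure.pi fun _ : ↥sV => (HaarData.haar : Measure (SU N)) with hν
  set ν' : Measure (↥sV' → SU N) := Measure.pi fun _ : ↥sV' => (HaarData.haar : Measure (SU N)) with hν'
  haveI : IsProbabilityMeasure μ := Missing.isProbabilityMeasure_fieldMeasure (F.P K) j
  haveI : IsProbabilityMeasure μ' := Missing.isProbabilityMeasure_fieldMeasure (F.P K) (j + 1)
  set av := (avOfRecord F N K j).avg with hav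
  have hmav : Measurable av := avOfRecord_measurable F N K j
  have hac : μ.map av ≪ μ' := avOfRecord_haarAC F N K j hj
  -- the restricted averaging on the full bond sets IS `av` read through the equivalences
  set avg' := avgRestrOfRecord F N K j sV sV' with havg'def
  have havg' : avg' = fun y => E'.symm (av (E y)) := by
    funext y b'
    have hupd : Function.updateFinset (fun _ : PBond (F.P K) j => (1 : SU N)) sV y = E y := by
      funext b
      rw [Function.updateFinset_def]
      simp only [dif_pos (hV b), hE]
    show (avOfRecord F N K j).avg (Function.updateFinset (fun _ => 1) sV y) b' = _
    rw [hupd, hEs']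
  have hmavg' : Measurable avg' := by
    rw [havg']; exact E'.symm.measurable.comp (hmav.comp E.measurable)
  have hac' : ν.map avg' ≪ ν' := by
    rw [havg']
    have h1 : ν.map (fun y => E'.symm (av (E y))) = ((ν.map E).map av).map E'.symm := by
      rw [Measure.map_map hmav E.measurable, Measure.map_map E'.symm.measurable (hmav.comp E.measurable)]
      rfl
    rw [h1, mpE.map_eq, ← mpE's.map_eq]
    exact hac.map E'.symm.measurable
  have hC0 : 0 ≤ C := le_trans (abs_nonneg _) (hC (fun _ => 1) (fun _ => 1))
  -- measurability of the two slice integrands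
  have hmB : Measurable (fun z : GaugeField (F.P K) (j + 1) (SU N) × GaugeField (F.P K) j (SU N) => f z.1 (E.symm z.2)) :=
    hf.comp (measurable_fst.prodMk (E.symm.measurable.comp measurable_snd))
  have hmA : Measurable (fun z : (↥sV' → SU N) × (↥sV → SU N) => f (E' z.1) z.2) :=
    hf.comp ((E'.measurable.comp measurable_fst).prodMk measurable_snd)
  -- integrability of the two transports
  have hintB : Integrable (fun V => kernelTransport μ μ' av (fun U => f V (E.symm U)) V) μ' := by
    have hgi : Integrable (fun z : GaugeField (F.P K) (j + 1) (SU N) × GaugeField (F.P K) j (SU N) => f z.1 (E.symm z.2)) (jointLaw μ av) :=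
      (integrable_const C).mono' hmB.aestronglyMeasurable (ae_of_all _ fun z => by rw [Real.norm_eq_abs]; exact hC _ _)
    have hI := (integrable_margDensity_mul μ μ' hmav hac hgi).integral_compProd
    refine hI.congr (ae_of_all _ fun V => ?_)
    simp only [kernelTransport]
    exact integral_const_mul _ _
  have hintA0 : Integrable (fun y' => kernelTransport ν ν' avg' (f (E' y')) y') ν' := by
    have hgi : Integrable (fun z : (↥sV' → SU N) × (↥sV → SU N) => f (E' z.1) z.2) (jointLaw ν avg') :=
      (integrable_const C).mono' hmA.aestronglyMeasurable (ae_of_all _ fun z => by rw [Real.norm_eq_abs]; exact hC _ _)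
    have hI := (integrable_margDensity_mul ν ν' hmavg' hac' hgi).integral_compProd
    refine hI.congr (ae_of_all _ fun y' => ?_)
    simp only [kernelTransport]
    exact integral_const_mul _ _
  have hintA : Integrable (fun V => kernelTransport ν ν' avg' (f V) (E'.symm V)) μ' := by
    have h := (mpE's.integrable_comp_emb E'.symm.measurableEmbedding).2 hintA0
    refine h.congr (ae_of_all _ fun V => ?_)
    simp only [Function.comp_def, E'.apply_symm_apply]
  -- the goal in E-form
  show (fun V => kernelTransport ν ν' avg' (f V) (E'.symm V)) =ᵐ[μ'] fun V => kernelTransport μ μ' av (fun U => f V (E.symm U)) V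
  refine ae_eq_of_forall_integral_mul_eq hintA hintB fun φ hφm ⟨Cφ, hφ⟩ => ?_
  have hbd : ∀ V y, |f V y * φ V| ≤ C * Cφ := fun V y => by
    rw [abs_mul]; exact mul_le_mul (hC V y) (hφ V) (abs_nonneg _) hC0
  -- B side: disintegration along `av`
  have hB : ∫ V, kernelTransport μ μ' av (fun U => f V (E.symm U)) V * φ V ∂μ' = ∫ U, f (av U) (E.symm U) * φ (av U) ∂μ := by
    have hgm : AEStronglyMeasurable (fun z : GaugeField (F.P K) (j + 1) (SU N) × GaugeField (F.P K) j (SU N) => f z.1 (E.symm z.2) * φ z.1)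
        (jointLaw μ av) := (hmB.mul (hφm.comp measurable_fst)).aestronglyMeasurable
    have hg : Integrable (fun U => f (av U) (E.symm U) * φ (av U)) μ :=
      (integrable_const (C * Cφ)).mono' ((hmB.mul (hφm.comp measurable_fst)).comp (hmav.prodMk measurable_id)).aestronglyMeasurable
        (ae_of_all _ fun U => by rw [Real.norm_eq_abs]; exact hbd _ _)
    have key := integral_graph_eq μ μ' hmav hac
      (g := fun z : GaugeField (F.P K) (j + 1) (SU N) × GaugeField (F.P K) j (SU N) => f z.1 (E.symm z.2) * φ z.1) hgm hg
    rw [key]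
    refine integral_congr_ae (ae_of_all _ fun V => ?_)
    simp only [kernelTransport]
    rw [integral_mul_const]
    ring
  -- A side: change variables `V = E′ y′`, disintegrate along `avg′`, change variables `y = E⁻¹ U`
  have hA : ∫ V, kernelTransport ν ν' avg' (f V) (E'.symm V) * φ V ∂μ' = ∫ U, f (av U) (E.symm U) * φ (av U) ∂μ := by
    have h1 : ∫ V, kernelTransport ν ν' avg' (f V) (E'.symm V) * φ V ∂μ' =
        ∫ y', kernelTransport ν ν' avg' (f (E' y')) y' * φ (E' y') ∂ν' := by
      rw [← mpE'.integral_comp E'.measurableEmbedding]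
      simp only [E'.symm_apply_apply]
    have hgm' : AEStronglyMeasurable (fun z : (↥sV' → SU N) × (↥sV → SU N) => f (E' z.1) z.2 * φ (E' z.1)) (jointLaw ν avg') :=
      (hmA.mul (hφm.comp (E'.measurable.comp measurable_fst))).aestronglyMeasurable
    have hg' : Integrable (fun y => f (E' (avg' y)) y * φ (E' (avg' y))) ν := by
      haveI : IsProbabilityMeasure ν := by rw [hν]; infer_instance
      exact (integrable_const (C * Cφ)).mono'
        ((hmA.mul (hφm.comp (E'.measurable.comp measurable_fst))).comp (hmavg'.prodMk measurable_id)).aestronglyMeasurable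
        (ae_of_all _ fun y => by rw [Real.norm_eq_abs]; exact hbd _ _)
    have key' := integral_graph_eq ν ν' hmavg' hac'
      (g := fun z : (↥sV' → SU N) × (↥sV → SU N) => f (E' z.1) z.2 * φ (E' z.1)) hgm' hg'
    have h2 : ∫ y', kernelTransport ν ν' avg' (f (E' y')) y' * φ (E' y') ∂ν' = ∫ y, f (E' (avg' y)) y * φ (E' (avg' y)) ∂ν := by
      rw [key']
      refine integral_congr_ae (ae_of_all _ fun y' => ?_)
      simp only [kernelTransport]
      rw [integral_mul_const]
      ring
    have h3 : ∫ y, f (E' (avg' y)) y * φ (E' (avg' y)) ∂ν = ∫ U, f (av U) (E.symm U) * φ (av U) ∂μ := by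
      rw [← mpEs.integral_comp E.symm.measurableEmbedding]
      refine integral_congr_ae (ae_of_all _ fun U => ?_)
      have hU : E' (avg' (E.symm U)) = av U := by
        rw [havg']
        simp only [E.apply_symm_apply, E'.apply_symm_apply]
      simp only [hU]
    rw [h1, h2, h3]
  rw [hA, hB]


/-- The `V`-independent case of the face: a bounded measurable function of the fine subtype configuration alone.
[cite: Balaban1988Convergent, (2.21)–(2.22) p.258, (3.1) p.264] -/
theorem kernelRTOfRecord_full_ae_eq_transportOfRecord_const (K j : ℕ) (hj : j < K) {hdec : DecidableEq (PBond (F.P K) j)}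
    (sV : Finset (PBond (F.P K) j)) (hV : ∀ b, b ∈ sV) (sV' : Finset (PBond (F.P K) (j + 1))) (hV' : ∀ b, b ∈ sV')
    (f : (↥sV → SU N) → ℝ) (hf : Measurable f) {C : ℝ} (hC : ∀ y, |f y| ≤ C) :
    (fun V => kernelRTOfRecord F N K j sV sV' f (fun b => V b)) =ᵐ[fieldMeasure (F.P K) (j + 1) (SU N)]
      transportOfRecord F N K j (fun U => f (fun b => U b)) :=
  kernelRTOfRecord_full_ae_eq_transportOfRecord F N K j hj sV hV sV' hV' (fun _ y => f y) (hf.comp measurable_snd) (fun _ y => hC y)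

/-! ## §2  The no-expansion generation of record (`Ω_{j+1}(s) = ∅`): full bond sets, no A-bonds, the generation unfolded -/

/-- A region containing every site of the fine torus carries every bond of `T^{(j)}` (both endpoints lie in it). [cite: Balaban1985Variational, (3) p.278 (bookkeeping)] -/
theorem mem_toFinset_bondsIn_of_forall_mem (K j : ℕ) {X : Set (Site (F.P K) 0)} (hX : ∀ x, x ∈ X) (b : PBond (F.P K) j) :
    b ∈ (Set.toFinite (B10Eq42TorusConstraint.bondsIn j X)).toFinset := by
  rw [Set.Finite.mem_toFinset, B10Eq42TorusConstraint.mem_bondsIn_iff]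
  exact ⟨hX _, hX _⟩

variable {F N}

/-- **At a NO-EXPANSION step `Ω_{j+1}(s) = ∅` the generation-`j` V-bond set of record is FULL** (the bonds in `Ω^c_{j+1} = T`).
[cite: Balaban1988Convergent, (2.21)–(2.22) p.258] -/
theorem mem_sV_of_Omega_empty (V : Type) (ν : Stage7Numerics) (M : ℕ) (g : ℕ → ℝ) (K : ℕ) (W : TkWeights F N V K) {k : ℕ}
    (s : SeqOfRecord F ν M g K k) (S : ℕ → Set (Site (F.P K) 0)) (j : ℕ) {hdec : DecidableEq (PBond (F.P K) j)} (hΩ : s.Ω (j + 1) = ∅)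
    (b : PBond (F.P K) j) : b ∈ (genDataOfRecord F N V ν M g K W s S j).sV := by
  show b ∈ (Set.toFinite (B10Eq42TorusConstraint.bondsIn j (s.Ω (j + 1))ᶜ)).toFinset
  exact mem_toFinset_bondsIn_of_forall_mem F K j (fun x => by rw [hΩ, Set.compl_empty]; exact Set.mem_univ x) b

/-- … and so is its image bond set at level `j+1`. [cite: Balaban1988Convergent, (2.21)–(2.22) p.258] -/
theorem mem_sV'_of_Omega_empty (V : Type) (ν : Stage7Numerics) (M : ℕ) (g : ℕ → ℝ) (K : ℕ) (W : TkWeights F N V K) {k : ℕ}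
    (s : SeqOfRecord F ν M g K k) (S : ℕ → Set (Site (F.P K) 0)) (j : ℕ) {hdec : DecidableEq (PBond (F.P K) j)} (hΩ : s.Ω (j + 1) = ∅)
    (b : PBond (F.P K) (j + 1)) : b ∈ (genDataOfRecord F N V ν M g K W s S j).sV' := by
  show b ∈ (Set.toFinite (B10Eq42TorusConstraint.bondsIn (j + 1) (s.Ω (j + 1))ᶜ)).toFinset
  exact mem_toFinset_bondsIn_of_forall_mem F K (j + 1) (fun x => by rw [hΩ, Set.compl_empty]; exact Set.mem_univ x) b

/-- **… and it has NO A-bonds** (`Z_{j+1} ∩ Ω_{j+1} = ∅`: (2.22), no fluctuation integral). [cite: Balaban1988Convergent, (2.22) p.258] -/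
theorem isEmpty_sA_of_Omega_empty (V : Type) (ν : Stage7Numerics) (M : ℕ) (g : ℕ → ℝ) (K : ℕ) (W : TkWeights F N V K) {k : ℕ}
    (s : SeqOfRecord F ν M g K k) (S : ℕ → Set (Site (F.P K) 0)) (j : ℕ) {hdec : DecidableEq (PBond (F.P K) j)} (hΩ : s.Ω (j + 1) = ∅) :
    IsEmpty ↥(genDataOfRecord F N V ν M g K W s S j).sA := by
  refine ⟨fun b => ?_⟩
  have hb : (b : PBond (F.P K) j) ∈ (Set.toFinite (B10Eq42TorusConstraint.bondsIn j ((s.Λ (j + 1))ᶜ ∩ s.Ω (j + 1)))).toFinset := b.2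
  rw [Set.Finite.mem_toFinset, B10Eq42TorusConstraint.mem_bondsIn_iff, hΩ, Set.inter_empty] at hb
  exact hb.1

/-- **THE NO-EXPANSION GENERATION OF RECORD, UNFOLDED** ((2.22) at the objects of record): at `Ω_{j+1}(s) = ∅` the generation `𝐓^{(j)}(s, S)` of 11a is the
restricted kernel transport of record ON THE FULL BOND SETS applied to `ζ_j(T)·w_A·(operand)` (the A-factor over the empty bond set is multiplication by its
weight, `Tk.aOp_of_isEmpty`), read at the level-`(j+1)` variables — the form §1 converts into def-T's `transportOfRecord` almost everywhere.
[cite: Balaban1988Convergent, (2.21)–(2.22) p.258, (3.24) p.270] -/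
theorem genOp_genDataOfRecord_of_Omega_empty (V : Type) [NormedAddCommGroup V] [InnerProductSpace ℝ V] [FiniteDimensional ℝ V]
    [MeasurableSpace V] [BorelSpace V] (ν : Stage7Numerics) (M : ℕ) (g : ℕ → ℝ) (K : ℕ) (W : TkWeights F N V K) {k : ℕ}
    (s : SeqOfRecord F ν M g K k) (S : ℕ → Set (Site (F.P K) 0)) (j : ℕ) {hdec : DecidableEq (PBond (F.P K) j)} (hΩ : s.Ω (j + 1) = ∅)
    (Φ : MultiCfg (F.P K) (SU N) V → ℝ) (ω : MultiCfg (F.P K) (SU N) V) :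
    genOp j (genDataOfRecord F N V ν M g K W s S j) Φ ω =
      kernelRTOfRecord F N K j (genDataOfRecord F N V ν M g K W s S j).sV (genDataOfRecord F N V ν M g K W s S j).sV'
        (fun y => W.ζ j (s.Ω (j + 1))ᶜ (Function.update ω j (Function.updateFinset (ω j).1 _ y, (ω j).2)) *
          (W.w j (s.Λ (j + 1)) ((s.Λ (j + 1))ᶜ ∩ s.Ω (j + 1)) (S (j + 1)) (Function.update ω j (Function.updateFinset (ω j).1 _ y, (ω j).2)) *
            Φ (Function.update ω j (Function.updateFinset (ω j).1 _ y, (ω j).2))))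
        (fun b => (ω (j + 1)).1 b) := by
  haveI := isEmpty_sA_of_Omega_empty V ν M g K W s S j (hdec := hdec) hΩ
  rw [genOp_apply, vOp_apply]
  simp only [zetaOp_apply, aOp_of_isEmpty]
  rfl

end Literature.MathematicalPhysics.QuantumFieldTheory.Balaban1983to89.Node00

end
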